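import Summits.ResolutionOfSingularities.ResolutionOfSingularities.Theorems.WeightedInvariantIota3DropDivCore
import Summits.ResolutionOfSingularities.ResolutionOfSingularities.Theorems.WeightedInvariantContactCentreFiltrationRegular
import Literature.RingTheory.RegularLocalRing.QuotientDVR
import HarnessLib

/-!
# (DROP)₃, (D-div) PROVED: over a DIVISOR centre (`dim S_P ≤ 1`) the weighted blow-up of the canonical centre has no singular
# successor — the drop conjunct holds vacuously (door `HypersurfaceCentreConstruction`, stmt-ResolutionOfSingularities-19897)

Helper for `stub_keyRungGrHomLE_three` (def-free, `--supports 19897`).  Sequel of …Iota3DropDivCore (the `B`-side core) and …Iota3DropTypeA.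
At a position `(S, f)` (`S` regular local, `0 ≠ f`), canonical centre `P ∋ f` with `topStratum ι₀ S f = V(P)` and `dim S_P ≤ 1`, and ANY
family `(u, w)` with `weightedMonomialIdeal u w m = jFlatT S f m`:
* the pieces are `𝒥ₘ = (𝔪_{S_P}^m) ∩ S` (`jFlatT_eq_cylinderAt_jContact`, `jContact_eq_pow_of_DVR`: `S_P` is a discrete valuation ring);
* some member `π := u_i ∈ P` is a uniformizer of `S_P` (else `P·S_P = 𝔪_{S_P} ≤ 𝔪_{S_P}²`), and `π` is PRIME in `S` (a member of a regular
  system of parameters, `IsRsopPart.prime`) — this needs the rsp data `span u = 𝔪_S`, `spanFinrank`, `span {u_i : w_i > 0} = P`;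
* hence `𝒥ₘ ⊆ (π^m)` (saturation by elements prime to `π`), `f = π^ν · v` with `π ∤ v`, `v ∉ P`, and `v` is a UNIT because `ord_S f = ord_{S_P} f = ν`
  on the top stratum; `f ∈ 𝒥_ν ∖ 𝒥_{ν+1}`;
* so `DivCentre.weightedDrop_of_principal` applies: **`DivCentre.weightedDrop_of_dim_le_one`** — `WeightedDrop ι S f P u w` for EVERY `ι`
  (all successors, homogeneous or not), in particular (D-div) of the (DROP)₃ census.
Consequently (DROP)₃ for the pair of record = TYPE (a) ✓ (…DropTypeA) + (D-div) ✓ (here) + (D-b) «`t`-homogeneous successors over the closed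
point in the point and curve regimes» [XL, the crux].
[OURS · L1 W4.3 · commutative algebra; AI work, weaker than expert review; nothing here is a statement of the manuscript under review.]

## References

* J. Włodarczyk, *Functorial resolution by torus actions*, arXiv:2203.03090, §3.3. [Wlodarczyk2022]
* H. Matsumura, *Commutative Ring Theory* (1987), Thm. 11.2 (regular local rings of dimension one are DVRs), Thm. 14.3. [Matsumura1987]
-/

noncomputable section

set_option linter.dupNamespace false -- mandated namespace of this single-conjunct summit

open IsLocalRing Literature.AlgebraicGeometry.Resolution
open Summit.ResolutionOfSingularities.ResolutionOfSingularities.Theorems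
open Summit.ResolutionOfSingularities.ResolutionOfSingularities.Theorems.ContactCylinder

namespace Summit.ResolutionOfSingularities.ResolutionOfSingularities.Cruxes.HypersurfaceCentreConstruction.LocalEngine

open Iota3

namespace DivCentre

/-- In a local domain of Krull dimension `≤ 1` containing a non-zero non-unit, the Krull dimension is exactly `1`. [folklore] -/
theorem ringKrullDim_eq_one_of_le_one {R : Type} [CommRing R] [IsDomain R] [IsNoetherianRing R] [IsLocalRing R]
    (hdim : ringKrullDim R ≤ 1) {x : R} (hx0 : x ≠ 0) (hx : x ∈ maximalIdeal R) : ringKrullDim R = 1 := by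
  have hlt : ¬ ringKrullDim R ≤ 0 := fun h0 => by
    haveI : Ring.KrullDimLE 0 R := Ring.krullDimLE_iff.mpr (by exact_mod_cast h0)
    have hbot : maximalIdeal R = ⊥ := IsLocalRing.isField_iff_maximalIdeal_eq.mp Ring.KrullDimLE.isField_of_isDomain
    rw [hbot] at hx
    exact hx0 (Ideal.mem_bot.mp hx)
  obtain ⟨a, ha⟩ := WithBot.ne_bot_iff_exists.mp (ringKrullDim_ne_bot (R := R))
  rw [← ha] at hdim hlt ⊢
  have ha1 : a ≤ 1 := by exact_mod_cast hdim
  have ha0 : a ≠ 0 := fun h => hlt (by rw [h]; exact_mod_cast le_rfl)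
  have : a = 1 := le_antisymm ha1 (Order.one_le_iff_ne_zero.mpr ha0)
  rw [this]
  rfl

/-- **(D-div): NO SINGULAR SUCCESSOR OVER A DIVISOR CENTRE.**  `S` regular local, `0 ≠ f`; `P` prime, `f ∈ P`, `topStratum ι₀ S f = V(P)`,
`dim S_P ≤ 1`; `(u, w)` a regular system of parameters with weights whose positively weighted members span `P` and whose weighted pieces
are `jFlatT S f`.  Then `WeightedDrop ι S f P u w` for EVERY `ι`: no successor prime of the cobordant blow-up off the vertex carries the
transform in `𝔪²`.  (See the module docstring; `B`-side by `weightedDrop_of_principal`.) [OURS · L1 W4.3 · (D-div)] -/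
theorem weightedDrop_of_dim_le_one (S : Type) [CommRing S] [IsRegularLocalRing S] {f : S} (hf0 : f ≠ 0)
    (P : Ideal S) [P.IsPrime] (hfP : f ∈ P) (hE : topStratum iotaOrdEpsTau S f = {𝔮 | P ≤ 𝔮.asIdeal})
    (hdimP : ringKrullDim (Localization.AtPrime P) ≤ 1)
    {n : ℕ} (u : Fin n → S) (w : Fin n → ℕ)
    (hspan : Ideal.span (Set.range u) = maximalIdeal S) (hrk : (maximalIdeal S).spanFinrank = n)
    (hctr : Ideal.span {x | ∃ i, 0 < w i ∧ x = u i} = P)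
    (hpres : ∀ m : ℕ, weightedMonomialIdeal u w m = jFlatT S f m)
    (ι : (R : Type) → [CommRing R] → R → Ordinal.{0}) :
    WeightedDrop ι S f P u w := by
  classical
  haveI : IsDomain S := isDomain_of_isRegularLocalRing S
  haveI hRreg : IsRegularLocalRing (Localization.AtPrime P) := isRegularLocalRing_localization_atPrime S P
  haveI : IsDomain (Localization.AtPrime P) := isDomain_of_isRegularLocalRing _
  have hφinj : Function.Injective (algebraMap S (Localization.AtPrime P)) :=
    IsLocalization.injective (Localization.AtPrime P) P.primeCompl_le_nonZeroDivisors
  have hf0' : algebraMap S (Localization.AtPrime P) f ≠ 0 := fun h => hf0 (hφinj (by rw [h, map_zero]))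
  have hfR : algebraMap S (Localization.AtPrime P) f ∈ maximalIdeal (Localization.AtPrime P) :=
    (IsLocalization.AtPrime.to_map_mem_maximal_iff (Localization.AtPrime P) P f).mpr hfP
  -- `S_P` is a discrete valuation ring
  have hdim1 : ringKrullDim (Localization.AtPrime P) = 1 := ringKrullDim_eq_one_of_le_one hdimP hf0' hfR
  haveI hDVR : IsDiscreteValuationRing (Localization.AtPrime P) :=
    Literature.RingTheory.RegularLocalRing.isDiscreteValuationRing_of_ringKrullDim_eq_one hdim1
  -- the pieces: `𝒥ₘ = (𝔪_{S_P}^m) ∩ S`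
  have hJ : ∀ m : ℕ, weightedMonomialIdeal u w m =
      (maximalIdeal (Localization.AtPrime P) ^ m).comap (algebraMap S (Localization.AtPrime P)) := fun m => by
    rw [hpres m, jFlatT_eq_cylinderAt_jContact S f m hE (hdimP.trans (by norm_num)), cylinderAt_def,
      jContact_eq_pow_of_DVR _ _ hf0' hfR]
  have hJ1 : weightedMonomialIdeal u w 1 = P := by
    rw [hJ 1, pow_one]
    exact Localization.AtPrime.under_maximalIdeal
  -- a positively weighted member `π = u i` which is a uniformizer of `S_P`
  obtain ⟨ϖ, hirr⟩ := IsDiscreteValuationRing.exists_irreducible (Localization.AtPrime P)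
  have h𝔪 : maximalIdeal (Localization.AtPrime P) = Ideal.span {ϖ} :=
    (IsDiscreteValuationRing.irreducible_iff_uniformizer ϖ).mp hirr
  have hex : ∃ i, 0 < w i ∧ algebraMap S (Localization.AtPrime P) (u i) ∉ maximalIdeal (Localization.AtPrime P) ^ 2 := by
    by_contra hall
    have hall' : ∀ i, 0 < w i →
        algebraMap S (Localization.AtPrime P) (u i) ∈ maximalIdeal (Localization.AtPrime P) ^ 2 := fun i hi => by
      by_contra h
      exact hall ⟨i, hi, h⟩
    have hle0 : Ideal.span {x | ∃ i, 0 < w i ∧ x = u i} ≤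
        (maximalIdeal (Localization.AtPrime P) ^ 2).comap (algebraMap S (Localization.AtPrime P)) := by
      rw [Ideal.span_le]
      rintro _ ⟨i, hi, rfl⟩
      exact hall' i hi
    have hle : P.map (algebraMap S (Localization.AtPrime P)) ≤ maximalIdeal (Localization.AtPrime P) ^ 2 :=
      Ideal.map_le_iff_le_comap.mpr (hctr ▸ hle0)
    rw [Localization.AtPrime.map_eq_maximalIdeal] at hle
    have hϖ : ϖ ∈ maximalIdeal (Localization.AtPrime P) ^ 2 := hle (by rw [h𝔪]; exact Ideal.mem_span_singleton_self ϖ)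
    rw [h𝔪, Ideal.span_singleton_pow, Ideal.mem_span_singleton] at hϖ
    obtain ⟨c, hc⟩ := hϖ
    have h1 : ϖ * 1 = ϖ * (ϖ * c) := by rw [mul_one, ← mul_assoc, ← pow_two]; exact hc
    exact hirr.not_isUnit (isUnit_iff_exists_inv.mpr ⟨c, (mul_left_cancel₀ hirr.ne_zero h1).symm⟩)
  obtain ⟨i₁, hwi₁, hπ2⟩ := hex
  set π : S := u i₁ with hπdef
  have hπP : π ∈ P := hctr ▸ Ideal.subset_span ⟨i₁, hwi₁, rfl⟩
  -- `π` is prime in `S` (a member of a regular system of parameters)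
  have hπprime : Prime π := by
    have h := (isRsopPart_comp_of_rsop hrk u hspan (fun _ : Fin 1 => i₁) (fun a b _ => Subsingleton.elim a b)).prime 0
    simpa using h
  -- `π/1` is a uniformizer: `𝔪_{S_P} = (π/1)`
  have hπR : algebraMap S (Localization.AtPrime P) π ∈ maximalIdeal (Localization.AtPrime P) :=
    (IsLocalization.AtPrime.to_map_mem_maximal_iff (Localization.AtPrime P) P π).mpr hπP
  have hunif : maximalIdeal (Localization.AtPrime P) = Ideal.span {algebraMap S (Localization.AtPrime P) π} := by
    have hne : Ideal.span {algebraMap S (Localization.AtPrime P) π} ≠ ⊥ := by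
      rw [Ne, Ideal.span_singleton_eq_bot]
      exact fun h => hπprime.ne_zero (hφinj (by rw [h, map_zero]))
    obtain ⟨k, hk⟩ := IsDiscreteValuationRing.ideal_eq_span_pow_irreducible hne hirr
    rcases Nat.lt_trichotomy k 1 with hlt | rfl | hgt
    · exfalso
      have hk0 : k = 0 := by omega
      rw [hk0, pow_zero, Ideal.span_singleton_one, Ideal.span_singleton_eq_top] at hk
      exact (mem_nonunits_iff.mp ((IsLocalRing.mem_maximalIdeal _).mp hπR)) hk
    · rw [pow_one] at hk
      rw [h𝔪, hk]
    · exfalso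
      apply hπ2
      have hmem : algebraMap S (Localization.AtPrime P) π ∈ maximalIdeal (Localization.AtPrime P) ^ k := by
        rw [h𝔪, Ideal.span_singleton_pow, ← hk]
        exact Ideal.mem_span_singleton_self _
      exact Ideal.pow_le_pow_right hgt hmem
  -- the pieces are divisible by the powers of `π`
  have hdiv : ∀ (m : ℕ) (a : S), a ∈ weightedMonomialIdeal u w m → π ^ m ∣ a := by
    intro m a ha
    rw [hJ m, Ideal.mem_comap, hunif, Ideal.span_singleton_pow, ← map_pow,
      show Ideal.span {algebraMap S (Localization.AtPrime P) (π ^ m)} =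
        (Ideal.span {π ^ m}).map (algebraMap S (Localization.AtPrime P)) by
          rw [Ideal.map_span, Set.image_singleton],
      IsLocalization.mem_map_algebraMap_iff P.primeCompl (Localization.AtPrime P)] at ha
    obtain ⟨⟨⟨i, hi⟩, ⟨s, hs⟩⟩, heq⟩ := ha
    have heq' : a * s = i := hφinj (by rw [map_mul]; exact heq)
    obtain ⟨c, hc⟩ := Ideal.mem_span_singleton.mp hi
    have hdvd : π ^ m ∣ a * s := ⟨c, by rw [heq', hc]⟩
    have hs' : s ∉ P := hs
    have hπs : ¬ π ∣ s := fun ⟨c, hc⟩ => hs' (hc ▸ P.mul_mem_right c hπP)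
    exact hπprime.pow_dvd_of_dvd_mul_right m hπs hdvd
  have hπ1 : π ∈ weightedMonomialIdeal u w 1 := by rw [hJ1]; exact hπP
  -- `f = π^ν v`, `π ∤ v`
  obtain ⟨ν, v, hvndvd, hfv⟩ := WfDvdMonoid.max_power_factor hf0 hπprime.irreducible
  have hvP : v ∉ P := fun h => hvndvd (by simpa using hdiv 1 v (by rw [hJ1]; exact h))
  have hν : 0 < ν := by
    rcases Nat.eq_zero_or_pos ν with h0 | h0
    · exfalso
      rw [h0, pow_zero, one_mul] at hfv
      exact hvP (hfv ▸ hfP)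
    · exact h0
  have hfν : v * π ^ ν ∈ weightedMonomialIdeal u w ν := by
    rw [hJ ν, Ideal.mem_comap, map_mul, map_pow]
    exact Ideal.mul_mem_left _ _ (Ideal.pow_mem_pow hπR ν)
  have hf1 : v * π ^ ν ∉ weightedMonomialIdeal u w (ν + 1) := fun h => by
    have hd := hdiv (ν + 1) _ h
    rw [pow_succ, mul_comm v] at hd
    exact hvndvd ((mul_dvd_mul_iff_left (pow_ne_zero ν hπprime.ne_zero)).mp hd)
  have hfeq : f = v * π ^ ν := by rw [hfv, mul_comm]
  -- `v` is a unit: `ord_S f = ord_{S_P} f = ν`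
  have hιP : iotaOrd (Localization.AtPrime P) (algebraMap S (Localization.AtPrime P) f) = iotaOrd S f := by
    have hmem : (⟨P, ‹_›⟩ : PrimeSpectrum S) ∈ topStratum iotaOrdEpsTau S f := by
      rw [hE]
      exact (le_rfl : P ≤ P)
    have h0 : iotaOrdEpsTau (Localization.AtPrime P) (algebraMap S (Localization.AtPrime P) f) = iotaOrdEpsTau S f := hmem
    exact ((iotaOrdEps_eq_iff _ _ _ _).mp ((iotaOrdEpsTau_eq_iff _ _ _ _).mp h0).1).1
  have hfR1 : algebraMap S (Localization.AtPrime P) f ∉ maximalIdeal (Localization.AtPrime P) ^ (ν + 1) := fun h =>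
    hf1 (by rw [hJ (ν + 1), Ideal.mem_comap, ← hfeq]; exact h)
  have hv : IsUnit v := by
    by_contra hvu
    have hvm : v ∈ maximalIdeal S := (IsLocalRing.mem_maximalIdeal _).mpr (mem_nonunits_iff.mpr hvu)
    have hfm : f ∈ maximalIdeal S ^ (ν + 1) := by
      rw [hfeq, pow_succ']
      exact Ideal.mul_mem_mul hvm (Ideal.pow_mem_pow (by rw [← hspan]; exact Ideal.subset_span ⟨i₁, rfl⟩) ν)
    have h1 : ((ν + 1 : ℕ) : Ordinal) ≤ iotaOrd S f := (natCast_le_iotaOrd_iff S f (ν + 1)).mpr hfm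
    rw [← hιP] at h1
    exact hfR1 ((natCast_le_iotaOrd_iff _ _ (ν + 1)).mp h1)
  rw [hfeq]
  exact weightedDrop_of_principal u w ι hv hν hπ1 hdiv hfν hf1 P

end DivCentre

end Summit.ResolutionOfSingularities.ResolutionOfSingularities.Cruxes.HypersurfaceCentreConstruction.LocalEngine

end
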